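import Summits.FinalStateConjecture.FinalStateConjecture.Theses.ZeroEnergyKerrOrBomb
import Summits.FinalStateConjecture.FinalStateConjecture.Theses.SwallowTheDatum
import Summits.FinalStateConjecture.FinalStateConjecture.Theorems.PhotonSphereChannelsTameCensorshipReduction
import Summits.FinalStateConjecture.FinalStateConjecture.Theorems.StationaryLimitReduction.Negative.KillShape
import Summits.FinalStateConjecture.FinalStateConjecture.Theorems.TameCensorship.Negative.GenericityAndFails
import Literature.Geometry.Lorentzian.StationaryFinalStateDecomposition
import Literature.Geometry.Lorentzian.LinearizedRicci
import Literature.Geometry.Lorentzian.Volume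
import Literature.Geometry.Lorentzian.KerrDataProofs
import Literature.Geometry.Lorentzian.KerrSchildCoord

/-!
# Line `symplectic-dual-of-the-bomb` — crux `StationaryLimitReduction`
# (route ZeroEnergyKerrOrBomb, item stmt-FinalStateConjecture-10021): CHECKED SKELETON

Crux (fixed, the route's): `StationaryLimitReduction : Prop := KerrOrBomb → FinalStateConjecture`.

Idea (crux-idea card `Ideas/symplectic-dual-of-the-bomb.md`, ideator 2; triage r1 3/3 pass): at the
stratum "the admissible datum `D` settles down to a black-hole BOMB" of the exceptional set, the
unstable eigendirection of the saddle is REALISED BY COMPACTLY SUPPORTED VACUUM DATA. The coefficient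
of the bomb's growing mode in a kicked development is the slice pairing of the kick with the DUAL MODE
(conserved Burnett–Wald / ADM symplectic current), carried back to the Cauchy surface `Σ₀ = ι(X)`,
where transversality is Moncrief's splitting: a linearised field whose Cauchy data are ω-orthogonal
to every compactly supported solution of the linearised vacuum constraints is pure gauge. No unique
continuation, no controllability (barrier `IonescuKlainermanNonExtension` evaded).

## Shape of the skeleton (5 registered stubs + the shared MGHD obligation by name)

The composition `StationaryLimitReduction_of` is DATUM-WISE (Disproof §5 / `GenericityAndFails`:
curve-genericity is not `∧`-closed, so no conjunction of generic clauses is ever formed — exactly ONE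
admissible curve is built through each exceptional datum) and uses the crux hypothesis `KerrOrBomb`
three times (naming the limits of `D`, of the cured members, and of the ejected members):

* `Sig.stub_nonSettlingCure` (the GLOBAL HALF every stationary-limit line owes; open-problem):
  an admissible datum whose MGHDs do NOT all settle (complete `𝓘⁺`, exhaustive stationary final-state
  decomposition with collar charts, REGULAR limit holes) lies on a local admissible curve whose other
  members settle to MODE-STABLE regular holes.
* `Sig.stub_kerrChartTransfer` (L): a stationary final-state decomposition whose holes are isometric
  to sub-extremal Kerr exteriors (`KerrOrBomb`'s fact-free conclusion) yields the summit's Kerr–Schild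
  `FinalStateDecomposition` with exhaustive charts (the "genuine lemma" flagged in
  `StationaryFinalStateDecomposition.lean`).
* `Sig.stub_probeUniversality` (the BRIDGE, XL; triage cross-cutting note 1): a regular hole that is
  NOT Killing-mode-stable for `□_g` carries a non-gauge growing GRAVITATIONAL Killing-mode pair.
* `Sig.stub_moncriefTransversality` (THIS CARD'S LEVER, L; card A2+A3 retyped per triage): at a point
  `x₀` of the slice free of Killing initial data, finitely many detectors `(Aⱼ, Bⱼ)` smooth near `x₀`,
  no combination of which is locally the tangent of a slice deformation (pure gauge), are realised by a
  compactly supported admissible `k`-parameter family with non-degenerate pairing matrix.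
* `Sig.stub_dualModeEjection` (XL/open; card residuals (S) saddle + (F) fate, with the dual-mode
  construction = conservation A1 + backward dual mode): for a bomb datum the dual modes' Cauchy data ARE
  such detectors, and every steerable family transversal to them contains a curve of data settling to
  mode-stable regular holes.
* `Theses.SwallowTheDatum.MGHDExists` (stmt-9937; Choquet-Bruhat–Geroch; shared by every route) BY NAME.

`KerrOrBomb` + transfer turn "settles to mode-stable regular holes" into the summit property
(`summitProperty_of_settlesWith`); a regularly settling exceptional datum therefore carries a bomb
(`exists_bomb`); Bridge → detectors → Moncrief family → steering close the bomb stratum; the tree's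
`isChristodoulouGeneric_one_of_local` (p70102) turns local curves into the typed genericity.

## Disproof.lean used (cdisprove cycle 1; landed `Negative/KillShape.lean`, p72863)

* `not_crux_iff` / `without_iff_summit`: NO `_false_without_<H>` theorem exists or can exist short of
  `¬FSC`, so there is no obstruction of that form to honour; the crux hypothesis `KerrOrBomb` is
  nevertheless USED (three times), so the skeleton is not of the `crux_of_summit` shape.
* §5 `genericity_not_and_closed` (re-export of `TameCensorship/Negative/GenericityAndFails`, imported
  below): honoured — one curve per datum; `stub_nonSettlingCure` and `stub_dualModeEjection` each
  conclude the single conjunctive property `SettlesWith ModeStable` for the SAME curve's members.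
* §6 note 1 (scalar proxy vs vacuum dynamics): is exactly `stub_probeUniversality`.
* §6 note 3 / sibling ZeroEnergyRigidity TRIAGE D-h3 (global horizon Killing field in
  `IsNonDegenerateHorizon`): `RegularHole` keeps the route's telescope VERBATIM (it is what `KerrOrBomb`
  consumes); the collar reading enters only as the extra clause "adapted charts cross `𝓗⁺`".
* No stub is an instance of a landed Negative lemma (`KillShape` is a logical skeleton only;
  `GenericityAndFails` kills `∧`-closure schemas, of which none occurs here). `ledger negatives`: 0.
-/

noncomputable section

set_option linter.dupNamespace false
set_option maxSynthPendingDepth 3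

open scoped Manifold ContDiff Topology BigOperators
open Set Filter Bundle MeasureTheory Literature.Geometry.Lorentzian
open Summit.FinalStateConjecture.FinalStateConjecture.Theses.ZeroEnergyKerrOrBomb

namespace Summit.FinalStateConjecture.FinalStateConjecture.Cruxes.StationaryLimitReduction.SymplecticDualOfTheBomb

/-! ## §0 Vocabulary (definitions over the tree; nothing is asserted here) -/

/-- The instance hypothesis `Kerr.Facts` of the Kerr–Schild prelude holds (three tree theorems). -/
theorem kerrFacts : Kerr.Facts :=
  ⟨Kerr.isConnected_region_holds, Kerr.contMDiff_bilin_holds, Kerr.contMDiff_timeVector_holds⟩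

/-- The summit property `P(D)` — verbatim the `fun D ↦ …` body of `FinalStateConjecture`. -/
abbrev SummitProperty (X : Type) [TopologicalSpace X] [ChartedSpace E3 X] [IsManifold (𝓡 3) ∞ X]
    [T2Space X] [SecondCountableTopology X] [ConnectedSpace X] (D : InitialDataSet (𝓡 3) X) : Prop :=
  (∃ 𝒟 : VacuumCauchyDevelopment D, 𝒟.IsMaximal) ∧
    ∀ 𝒟 : VacuumCauchyDevelopment D, 𝒟.IsMaximal →
      Summit.FinalStateConjecture.HasCompleteNullInfinity 𝒟.toCauchyDevelopment ∧
        ∃ (O : Set 𝒟.carrier) (d : FinalStateDecomposition 𝒟.toSpacetime O 2),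
          (∀ i, Kerr.IsSubextremal (d.mass i) (d.spin i)) ∧
            O = Summit.FinalStateConjecture.exteriorOf 𝒟.toCauchyDevelopment d.charted ∧
              Summit.FinalStateConjecture.HasExhaustiveCharts d

/-- Read-back: the summit is curve-genericity of `SummitProperty` (definitional). -/
theorem finalStateConjecture_iff :
    _root_.FinalStateConjecture ↔
      ∀ (X : Type) [TopologicalSpace X] [ChartedSpace E3 X] [IsManifold (𝓡 3) ∞ X] [T2Space X]
        [SecondCountableTopology X] [ConnectedSpace X],
        InitialDataSet.IsChristodoulouGeneric (admissibleVacuumData X) (SummitProperty X) 1 :=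
  Iff.rfl

/-- **The telescope of `KerrOrBomb`** — a REGULAR stationary vacuum hole: Ricci-flat, connected
horizon, non-degenerate horizon (the route's `IsNonDegenerateHorizon`, verbatim), globally hyperbolic
carrier, stationary field nowhere zero on the d.o.c. (Levi-Civita instance bound as in the route). -/
def RegularHole (𝓑 : StationaryAFBlackHole.{0}) : Prop :=
  ∀ [𝓑.metric.HasLeviCivita],
    𝓑.metric.toPseudoRiemannianMetric.IsRicciFlat ∧ IsConnected 𝓑.horizon ∧
      𝓑.toSpacetime.IsNonDegenerateHorizon 𝓑.Mext ∧
        𝓑.metric.IsGloballyHyperbolic 𝓑.timeOrientation ∧ ∀ p ∈ 𝓑.doc, 𝓑.killing p ≠ 0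

/-- **Killing-mode stability** of `□_g` — verbatim the mode-stability hypothesis of `KerrOrBomb`
(`= StationaryAFBlackHole.IsKillingModeStable` by `Iff.rfl`, not imported to keep the cone narrow). -/
def ModeStable (𝓑 : StationaryAFBlackHole.{0}) : Prop :=
  ∀ [𝓑.metric.HasLeviCivita],
    ∀ (ν ϖ : ℝ) (ψ χ : 𝓑.carrier → ℝ), 0 < ν →
      (∃ U : Set 𝓑.carrier, IsOpen U ∧ 𝓑.doc ∪ 𝓑.horizon ⊆ U ∧
        ContMDiffOn (𝓡 4) 𝓘(ℝ, ℝ) ((⊤ : ℕ∞) : WithTop ℕ∞) ψ U ∧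
          ContMDiffOn (𝓡 4) 𝓘(ℝ, ℝ) ((⊤ : ℕ∞) : WithTop ℕ∞) χ U) →
      (∀ x ∈ 𝓑.doc, 𝓑.metric.dalembertian ψ x = 0 ∧ 𝓑.metric.dalembertian χ x = 0) →
      (∀ x ∈ 𝓑.doc, mfderiv (𝓡 4) 𝓘(ℝ, ℝ) ψ x (𝓑.killing x) = ν * ψ x - ϖ * χ x ∧
        mfderiv (𝓡 4) 𝓘(ℝ, ℝ) χ x (𝓑.killing x) = ϖ * ψ x + ν * χ x) →
      (∃ C : ℝ, ∀ x ∈ 𝓑.doc ∩ 𝓑.metric.chronologicalPast 𝓑.timeOrientation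
        (𝓑.embed '' 𝓑.e.far (𝓑.e.R + 1)), |ψ x| ≤ C ∧ |χ x| ≤ C) →
      ∀ x ∈ 𝓑.doc, ψ x = 0 ∧ χ x = 0

/-- **The fact-free conclusion of `KerrOrBomb`**: the d.o.c. of `𝓑` is the image of a smooth injective
isometric immersion of a sub-extremal ingoing Kerr–Schild exterior chart. -/
def IsKerrIsometric [Kerr.Facts] (𝓑 : StationaryAFBlackHole.{0}) : Prop :=
  ∃ (M a : ℝ), Kerr.IsSubextremal M a ∧ ∃ Ψ : Kerr.exterior M a → 𝓑.carrier,
    Function.Injective Ψ ∧ Set.range Ψ = 𝓑.doc ∧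
      PseudoRiemannianMetric.IsIsometricImmersion
        (Kerr.smoothMetric M a (Kerr.rPlus M a)).toPseudoRiemannianMetric
        𝓑.metric.toPseudoRiemannianMetric Ψ

/-- Fields of continuous bilinear forms on the tangent bundle of a stationary hole (metric
perturbations `h_{ab}`). -/
abbrev HoleBilinField (𝓑 : StationaryAFBlackHole.{0}) : Type :=
  Π p : 𝓑.carrier, TangentSpace (𝓡 4) p →L[ℝ] TangentSpace (𝓡 4) p →L[ℝ] ℝ

/-- **A growing GRAVITATIONAL Killing-mode pair `(h₁, h₂)` of rate `ν + iϖ` of the hole `𝓑`, read in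
the adapted chart `A`** (the tensor twin of the route's scalar `IsKillingModePair`; card stub
"ProbeUniversality", triage r1-1 (b) / r1-3 cross-cutting note 1 with the regularity and outgoing
clauses spelled out): both fields symmetric; smooth on an open set containing `d.o.c. ∪ 𝓗⁺`
(regular at the future horizon); solving linearised vacuum gravity `DRic_g(hᵢ) = 0` on the d.o.c.;
Killing eigen-equations `𝓛_T h₁ = ν h₁ − ϖ h₂`, `𝓛_T h₂ = ϖ h₁ + ν h₂` on the d.o.c.; OUTGOING in the
sense of the route (chart components bounded on the part of the d.o.c. in the chronological past of the
far slice region); and NOT pure gauge on the d.o.c. (no smooth `ξ₁, ξ₂` with `hᵢ = 𝓛_{ξᵢ} g` there). -/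
def IsGravitationalModePair (𝓑 : StationaryAFBlackHole.{0}) (A : 𝓑.AdaptedChart) (ν ϖ : ℝ)
    (h₁ h₂ : HoleBilinField 𝓑) : Prop :=
  haveI : 𝓑.metric.HasLeviCivita := 𝓑.metric.hasLeviCivita
  (∀ p (v w : TangentSpace (𝓡 4) p), h₁ p v w = h₁ p w v ∧ h₂ p v w = h₂ p w v) ∧
  (∃ U : Set 𝓑.carrier, IsOpen U ∧ 𝓑.doc ∪ 𝓑.horizon ⊆ U ∧
    ContMDiffOn (𝓡 4) ((𝓡 4).prod 𝓘(ℝ, E4 →L[ℝ] E4 →L[ℝ] ℝ)) ∞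
      (fun p ↦ TotalSpace.mk' (E4 →L[ℝ] E4 →L[ℝ] ℝ)
        (E := fun p : 𝓑.carrier ↦ TangentSpace (𝓡 4) p →L[ℝ] TangentSpace (𝓡 4) p →L[ℝ] ℝ) p (h₁ p)) U ∧
    ContMDiffOn (𝓡 4) ((𝓡 4).prod 𝓘(ℝ, E4 →L[ℝ] E4 →L[ℝ] ℝ)) ∞
      (fun p ↦ TotalSpace.mk' (E4 →L[ℝ] E4 →L[ℝ] ℝ)
        (E := fun p : 𝓑.carrier ↦ TangentSpace (𝓡 4) p →L[ℝ] TangentSpace (𝓡 4) p →L[ℝ] ℝ) p (h₂ p)) U) ∧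
  (∀ p ∈ 𝓑.doc, 𝓑.metric.toPseudoRiemannianMetric.linearizedRicci h₁ p = 0 ∧
    𝓑.metric.toPseudoRiemannianMetric.linearizedRicci h₂ p = 0) ∧
  (∀ p ∈ 𝓑.doc,
    𝓑.metric.toPseudoRiemannianMetric.lieDerivBilin 𝓑.killing h₁ p = ν • h₁ p - ϖ • h₂ p ∧
      𝓑.metric.toPseudoRiemannianMetric.lieDerivBilin 𝓑.killing h₂ p = ϖ • h₁ p + ν • h₂ p) ∧
  (∃ C : ℝ, ∀ x : A.domain, A.toFun x ∈ 𝓑.doc ∩ 𝓑.metric.chronologicalPast 𝓑.timeOrientation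
      (𝓑.embed '' 𝓑.e.far (𝓑.e.R + 1)) → ∀ v w : E4,
    |pullbackBilin (I := 𝓡 4) (I' := 𝓘(ℝ, E4)) A.toFun h₁ x v w| ≤ C * ‖v‖ * ‖w‖ ∧
      |pullbackBilin (I := 𝓡 4) (I' := 𝓘(ℝ, E4)) A.toFun h₂ x v w| ≤ C * ‖v‖ * ‖w‖) ∧
  ¬ ∃ ξ₁ ξ₂ : (p : 𝓑.carrier) → TangentSpace (𝓡 4) p,
      ContMDiffOn (𝓡 4) ((𝓡 4).prod 𝓘(ℝ, E4)) ∞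
        (fun p ↦ (TotalSpace.mk' E4 p (ξ₁ p) : TangentBundle (𝓡 4) 𝓑.carrier)) 𝓑.doc ∧
      ContMDiffOn (𝓡 4) ((𝓡 4).prod 𝓘(ℝ, E4)) ∞
        (fun p ↦ (TotalSpace.mk' E4 p (ξ₂ p) : TangentBundle (𝓡 4) 𝓑.carrier)) 𝓑.doc ∧
      ∀ p ∈ 𝓑.doc, h₁ p = 𝓑.metric.toPseudoRiemannianMetric.lieDerivBilin ξ₁ 𝓑.metric.val p ∧
        h₂ p = 𝓑.metric.toPseudoRiemannianMetric.lieDerivBilin ξ₂ 𝓑.metric.val p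

section Slice

variable {X : Type} [TopologicalSpace X] [ChartedSpace E3 X] [IsManifold (𝓡 3) ∞ X]

/-- Fields of continuous bilinear forms on the slice (the type of `D.k`, of `δh`, `δk`, detectors). -/
abbrev BilinField (X : Type) [TopologicalSpace X] [ChartedSpace E3 X] : Type :=
  Π x : X, TangentSpace (𝓡 3) x →L[ℝ] TangentSpace (𝓡 3) x →L[ℝ] ℝ

/-- The `h`-inner product `S_{ij} T^{ij} = tr (♯S ∘ ♯Tᵗ)` of two bilinear forms at `x` (the
polarisation of `PseudoRiemannianMetric.normSq`). -/
def symInner (D : InitialDataSet (𝓡 3) X) (x : X)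
    (S T : TangentSpace (𝓡 3) x →L[ℝ] TangentSpace (𝓡 3) x →L[ℝ] ℝ) : ℝ :=
  LinearMap.trace ℝ (TangentSpace (𝓡 3) x)
    (((D.metric.sharp x).toLinearMap ∘ₗ S.toLinearMap₁₂) ∘ₗ
      ((D.metric.sharp x).toLinearMap ∘ₗ T.toLinearMap₁₂.flip))

/-- The `h`-trace `h^{ij} S_{ij}` of a bilinear form at `x`. -/
def hTrace (D : InitialDataSet (𝓡 3) X) (x : X)
    (S : TangentSpace (𝓡 3) x →L[ℝ] TangentSpace (𝓡 3) x →L[ℝ] ℝ) : ℝ :=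
  D.metric.trace x S.toLinearMap₁₂

/-- **The ADM symplectic density in the variables `(δh, δk)`.** With `π^{ij} = √h (k^{ij} − K h^{ij})`
and two variations `(a₁, b₁) = (A, B)`, `(a₂, b₂) = (a, b)` of `(h, k)`, the antisymmetrised
`δ₁π^{ij} δ₂h_{ij} − δ₂π^{ij} δ₁h_{ij}` divided by `√h` is (the `tr(k a₁ a₂)` and `K⟨a₁, a₂⟩` terms being
symmetric) `⟨b₁,a₂⟩ − ⟨b₂,a₁⟩ − tr b₁ tr a₂ + tr b₂ tr a₁ − ½ tr a₁ ⟨k,a₂⟩ + ½ tr a₂ ⟨k,a₁⟩`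
(ADM 1962; Moncrief 1975 §II; the overall sign / the tree's sign of `k` are immaterial below, where the
density is only ever compared with `0`). -/
def omegaDensity (D : InitialDataSet (𝓡 3) X) (A B a b : BilinField X) (x : X) : ℝ :=
  symInner D x (B x) (a x) - symInner D x (b x) (A x)
    - hTrace D x (B x) * hTrace D x (a x) + hTrace D x (b x) * hTrace D x (A x)
    - hTrace D x (A x) * symInner D x (D.k x) (a x) / 2
    + hTrace D x (a x) * symInner D x (D.k x) (A x) / 2

/-- **The slice pairing `ω_{Σ₀}((A,B),(a,b))` read in the extended chart at `x₀`**: the integral of the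
symplectic density against `√(det h_{ij}) dy` over the chart target (`chartGramMatrix`, `Volume.lean`).
It is the invariant ADM pairing whenever `(a, b)` vanishes off a compact subset of the chart source —
the only way it is used below. -/
def chartPairing (D : InitialDataSet (𝓡 3) X) (x₀ : X) (A B a b : BilinField X) : ℝ :=
  ∫ y in (extChartAt (𝓡 3) x₀).target,
    omegaDensity D A B a b ((extChartAt (𝓡 3) x₀).symm y) *
      Real.sqrt (chartGramMatrix D.h x₀ y).det

/-- First-order tangent (metric part) at `c = 0` of a `k`-parameter family of data in the `j`-th
parameter direction: `∂/∂c_j h_c(x)|₀` (a derivative in the fibre, definitionally the model space). -/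
def famTangentH {k : ℕ} (G : EuclideanSpace ℝ (Fin k) → InitialDataSet (𝓡 3) X) (j : Fin k) :
    BilinField X :=
  fun x ↦ deriv (fun s : ℝ ↦ (show E3 →L[ℝ] E3 →L[ℝ] ℝ from (G (EuclideanSpace.single j s)).h.inner x)) 0

/-- First-order tangent (`k` part): `∂/∂c_j k_c(x)|₀`. -/
def famTangentK {k : ℕ} (G : EuclideanSpace ℝ (Fin k) → InitialDataSet (𝓡 3) X) (j : Fin k) :
    BilinField X :=
  fun x ↦ deriv (fun s : ℝ ↦ (show E3 →L[ℝ] E3 →L[ℝ] ℝ from (G (EuclideanSpace.single j s)).k x)) 0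

/-- The `k × k` pairing matrix of the tangents of a `k`-parameter family against `k` detectors
`(A l, B l)`, entry `(j, l) = ω((A l, B l), ∂_j G|₀)`. -/
def pairingMatrix (D : InitialDataSet (𝓡 3) X) (x₀ : X) {k : ℕ} (A B : Fin k → BilinField X)
    (G : EuclideanSpace ℝ (Fin k) → InitialDataSet (𝓡 3) X) : Matrix (Fin k) (Fin k) ℝ :=
  Matrix.of fun j l ↦ chartPairing D x₀ (A l) (B l) (famTangentH G j) (famTangentK G j)

/-- The family `G` is a deformation of `D` supported in `K`: `G c = D` off `K` for every parameter. -/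
def IsSupportedIn (D : InitialDataSet (𝓡 3) X) {k : ℕ}
    (G : EuclideanSpace ℝ (Fin k) → InitialDataSet (𝓡 3) X) (K : Set X) : Prop :=
  ∀ c x, x ∉ K → (G c).h.inner x = D.h.inner x ∧ (G c).k x = D.k x

/-- Smoothness of a bilinear-form field on a set (as a section of `Hom(TX, Hom(TX, ℝ))`, the spelling
of `InitialDataSet.contMDiff_k`). -/
def SmoothBilinOn (A : BilinField X) (V : Set X) : Prop :=
  ContMDiffOn (𝓡 3) ((𝓡 3).prod 𝓘(ℝ, E3 →L[ℝ] E3 →L[ℝ] ℝ)) ∞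
    (fun x ↦ TotalSpace.mk' (E3 →L[ℝ] E3 →L[ℝ] ℝ)
      (E := fun x : X ↦ TangentSpace (𝓡 3) x →L[ℝ] TangentSpace (𝓡 3) x →L[ℝ] ℝ) x (A x)) V

variable [T2Space X] [SecondCountableTopology X] [ConnectedSpace X] {D : InitialDataSet (𝓡 3) X}

/-- **`(A, B)` is LOCALLY PURE GAUGE at `x₀`** (Moncrief's gauge directions `J∘DΦ*(N, Y)`, typed
convention-free): on some neighbourhood `V` of `x₀` it is the first variation at `s = 0` of the Cauchy
data `(ι_s^* g, K_{ν_s})` induced on a jointly smooth one-parameter deformation `ι_s` of the slice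
`ι_0 = ι` inside the vacuum development `𝒟`, `ν_s` the future unit normals (the infinitesimal
lapse–shift `(N, Y)` is the normal/tangential part of `∂_s ι_s|₀`; no condition off `V`). -/
def IsLocalSliceTangentAt (𝒟 : VacuumCauchyDevelopment D) (A B : BilinField X) (x₀ : X) : Prop :=
  haveI : 𝒟.metric.toPseudoRiemannianMetric.HasLeviCivita := 𝒟.metric.hasLeviCivita
  ∃ (V : Set X) (δ : ℝ), IsOpen V ∧ x₀ ∈ V ∧ 0 < δ ∧
    ∃ (ι : ℝ → X → 𝒟.carrier) (ν : (s : ℝ) → NormalField (𝓡 4) (ι s)),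
      ι 0 = 𝒟.embed ∧
      ContMDiffOn (𝓘(ℝ, ℝ).prod (𝓡 3)) (𝓡 4) ∞ (fun p : ℝ × X ↦ ι p.1 p.2) (Set.Ioo (-δ) δ ×ˢ V) ∧
      (∀ s ∈ Set.Ioo (-δ) δ, ∀ y ∈ V,
        (∀ v : TangentSpace (𝓡 3) y,
          𝒟.metric.val (ι s y) (ν s y) (mfderiv (𝓡 3) (𝓡 4) (ι s) y v) = 0) ∧
        𝒟.metric.val (ι s y) (ν s y) (ν s y) = -1 ∧
        𝒟.timeOrientation.IsFutureDirected (ν s y)) ∧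
      ∀ y ∈ V, ∀ v w : TangentSpace (𝓡 3) y,
        HasDerivAt (fun s : ℝ ↦ pullbackBilin (I := 𝓡 4) (I' := 𝓡 3) (ι s) 𝒟.metric.val y v w)
          (A y v w) 0 ∧
        HasDerivAt (fun s : ℝ ↦
          𝒟.metric.toPseudoRiemannianMetric.secondFundamentalForm (𝓡 3) (ι s) (ν s) y v w) (B y v w) 0

/-- **No Killing initial data near `x₀`** (KIDs = Killing fields of the development, Moncrief 1975):
on some neighbourhood `V` of `x₀`, every vector field which is smooth and Killing on an open set of
the development containing `ι(V)` vanishes on `ι(V)` (hence, its full 1-jet vanishing there, near it).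
The hypothesis under which compactly supported solutions of the constraints near `x₀` form a manifold
with tangent space the compactly supported linearised solutions (Corvino–Schoen, Chruściel–Delay). -/
def HasNoLocalKillingFieldNear (𝒟 : VacuumCauchyDevelopment D) (x₀ : X) : Prop :=
  haveI : 𝒟.metric.toPseudoRiemannianMetric.HasLeviCivita := 𝒟.metric.hasLeviCivita
  ∃ V : Set X, IsOpen V ∧ x₀ ∈ V ∧
    ∀ (W : Set 𝒟.carrier), IsOpen W → 𝒟.embed '' V ⊆ W →
      ∀ ξ : (p : 𝒟.carrier) → TangentSpace (𝓡 4) p,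
        ContMDiffOn (𝓡 4) ((𝓡 4).prod 𝓘(ℝ, E4)) ∞
          (fun p ↦ (TotalSpace.mk' E4 p (ξ p) : TangentBundle (𝓡 4) 𝒟.carrier)) W →
        (∀ p ∈ W, ∀ Y₀ Z₀ : TangentSpace (𝓡 4) p,
          𝒟.metric.val p (𝒟.metric.toPseudoRiemannianMetric.leviCivita ξ p Y₀) Z₀ +
            𝒟.metric.val p Y₀ (𝒟.metric.toPseudoRiemannianMetric.leviCivita ξ p Z₀) = 0) →
        ∀ x ∈ V, ξ (𝒟.embed x) = 0

/-- **Detectors at `x₀`**: `k` pairs `(Aⱼ, Bⱼ)` of bilinear-form fields on the slice such that `x₀` is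
free of local Killing initial data, every `Aⱼ, Bⱼ` is smooth on a neighbourhood of `x₀` (they may be
rough — e.g. conormal along a 2-surface — elsewhere), and NO non-trivial real combination of them is
locally pure gauge at `x₀`. -/
def AreDetectorsAt (𝒟 : VacuumCauchyDevelopment D) (x₀ : X) {k : ℕ} (A B : Fin k → BilinField X) :
    Prop :=
  HasNoLocalKillingFieldNear 𝒟 x₀ ∧
  (∃ V : Set X, IsOpen V ∧ x₀ ∈ V ∧ ∀ j, SmoothBilinOn (A j) V ∧ SmoothBilinOn (B j) V) ∧
  ∀ a : Fin k → ℝ, a ≠ 0 →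
    ¬ IsLocalSliceTangentAt 𝒟 (fun x ↦ ∑ j, a j • A j x) (fun x ↦ ∑ j, a j • B j x) x₀

end Slice

/-- **"Every MGHD of `D` settles down to regular stationary vacuum holes with property `Q`"**: every
maximal vacuum Cauchy development has complete `𝓘⁺` (sojourn form) and a `C²` stationary final-state
decomposition `d` (`StationaryFinalStateDecomposition`, definition D3 of the route) of its
self-determined exterior `O = J⁺(ιX) ∩ I⁻(d.charted)` with EXHAUSTIVE charts, whose adapted hole
charts cross the future event horizons (collar) and whose holes are REGULAR (`KerrOrBomb`'s telescope)
and satisfy `Q`. MGHD existence is NOT included (it is the shared obligation `MGHDExists`). -/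
def SettlesWith (Q : StationaryAFBlackHole.{0} → Prop) (X : Type) [TopologicalSpace X]
    [ChartedSpace E3 X] [IsManifold (𝓡 3) ∞ X] [T2Space X] [SecondCountableTopology X]
    [ConnectedSpace X] (D : InitialDataSet (𝓡 3) X) : Prop :=
  ∀ 𝒟 : VacuumCauchyDevelopment D, 𝒟.IsMaximal →
    Summit.FinalStateConjecture.HasCompleteNullInfinity 𝒟.toCauchyDevelopment ∧
      ∃ (O : Set 𝒟.carrier) (d : StationaryFinalStateDecomposition 𝒟.toSpacetime O 2),
        O = Summit.FinalStateConjecture.exteriorOf 𝒟.toCauchyDevelopment d.charted ∧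
          d.HasExhaustiveCharts ∧
            ∀ i, (d.hole i).horizon ⊆ Set.range (d.adapted i).toFun ∧
              RegularHole (d.hole i) ∧ Q (d.hole i)

/-! ## §1 The five stub statements (precise `Prop`s `Sig.stub_<name>`; the REGISTERED stubs are
`theorem stub_<name> : Sig.stub_<name> := by sorry` in §2; `StationaryLimitReduction_of` takes the five
signatures + `MGHDExists` as hypotheses BY NAME). -/

/-- **Stub 1 · `kerrChartTransfer` — Kerr-isometric stationary limits give the summit's Kerr–Schild
decomposition** (size L; chart bookkeeping + causal geometry, no dynamics; the "genuine lemma" left to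
the requesting route by `StationaryFinalStateDecomposition.lean`, module docstring "What is NOT proved
here"). For an MGHD `𝒟` and a `C²` stationary final-state decomposition `d` of
`O = exteriorOf 𝒟 d.charted` with exhaustive charts, collar hole charts across `𝓗⁺` and regular holes,
each of whose holes has d.o.c. isometric to a sub-extremal Kerr exterior (`IsKerrIsometric`,
`KerrOrBomb`'s fact-free conclusion): there is a `FinalStateDecomposition d'` (boosted Kerr–Schild
backgrounds) of some `O' = exteriorOf 𝒟 d'.charted` in `C²`, sub-extremal, with exhaustive charts.
WHY PLAUSIBLY TRUE: the Killing field `Ψ⁻¹_* T` of the Kerr exterior is timelike at infinity, hence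
`c ∂_{t*}` (`c > 0` after composing with the `(t, φ) ↦ (−t, −φ)` isometry if needed), so the transition
from the `T`-adapted chart to ingoing Kerr–Schild coordinates is time-equivariant and — both charts being
regular ACROSS `𝓗⁺` (collar clause) — has `C³` bounds on compact radius ranges uniform in time; `C²`
convergence on adapted slabs `{t = τ, r ≤ R}` for all large `τ` then gives it on Kerr–Schild slabs
(bounded time windows), the flat chart, motions and excision tubes are kept, hole charts are
re-normalised to the event horizons, and exhaustiveness passes to `O' ⊆ O`. WHY IT MIGHT FAIL: the
horizon re-normalisation and the comparison of the two slab families inside the ergoregion (where `T` is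
not timelike) need causal bookkeeping not yet in the tree; the summit's `HasExhaustiveCharts` is
demanded for EVERY chart time. Sources: arXiv:0806.0016 (Chruściel–Costa, Thm 1.3, §2.2),
arXiv:1710.01722 (Conjecture 1), arXiv:2104.08222 §1. -/
def Sig.stub_kerrChartTransfer : Prop :=
  ∀ [Kerr.Facts] (X : Type) [TopologicalSpace X] [ChartedSpace E3 X] [IsManifold (𝓡 3) ∞ X]
    [T2Space X] [SecondCountableTopology X] [ConnectedSpace X] (D : InitialDataSet (𝓡 3) X)
    (𝒟 : VacuumCauchyDevelopment D) (O : Set 𝒟.carrier)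
    (d : StationaryFinalStateDecomposition 𝒟.toSpacetime O 2),
    O = Summit.FinalStateConjecture.exteriorOf 𝒟.toCauchyDevelopment d.charted →
    d.HasExhaustiveCharts →
    (∀ i, (d.hole i).horizon ⊆ Set.range (d.adapted i).toFun ∧ RegularHole (d.hole i)) →
    (∀ i, IsKerrIsometric (d.hole i)) →
    ∃ (O' : Set 𝒟.carrier) (d' : FinalStateDecomposition 𝒟.toSpacetime O' 2),
      (∀ i, Kerr.IsSubextremal (d'.mass i) (d'.spin i)) ∧
        O' = Summit.FinalStateConjecture.exteriorOf 𝒟.toCauchyDevelopment d'.charted ∧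
          Summit.FinalStateConjecture.HasExhaustiveCharts d'

/-- **Stub 2 · `nonSettlingCure` — the global half: data that do not settle regularly are curable**
(size: open problem; weak cosmic censorship in Christodoulou's instability form + large-data settling to
stationary states + a dynamical third law + no-parking, for the PERTURBED data — owed by every
stationary-limit line, cf. the route's foreseen child `SettlesToStationary`; deliberately kept as ONE
curve statement because of Disproof §5). SCOPE: "settles regularly" means settling to holes in
`KerrOrBomb`'s telescope VERBATIM, so every TelescopeOfLimits debt sits on the HYPOTHESIS side of this stub
— a datum whose MGHD settles to a stationary vacuum hole lacking a connected horizon (parking), a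
non-degenerate horizon (third law), `T ≠ 0` on the d.o.c., or the GLOBAL horizon Killing field of
`IsNonDegenerateHorizon` (D-h3 of `Cruxes/ZeroEnergyRigidity/TRIAGE-r1-1.md`: Hawking rigidity of the limit)
counts as NON-settling here and is this stub's to cure; the planner's pending collar-form restate of h3
lightens it. For an admissible datum `D` NOT all of whose MGHDs settle
(complete `𝓘⁺`, exhaustive `C²` stationary decomposition with collar charts and REGULAR holes —
`SettlesWith (fun _ ↦ True)`), there is a jointly smooth family `F`, `F 0 = D`, injective and admissible
for `|c₀| < ε`, whose members `F c`, `0 < |c₀| < ε`, DO settle, and to MODE-STABLE regular holes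
(`SettlesWith ModeStable`; under `KerrOrBomb` these are Kerr — the stub itself never mentions Kerr).
WHY PLAUSIBLY TRUE: it is the folklore content of the final state conjecture on the complement of the
bomb stratum (naked singularities: Christodoulou's trapped-surface-formation instability, Ann. Math. 149
(1999) Thm 4.1, and arXiv:0805.3880; extremal remnants: the third law as a non-generic phenomenon,
Kehle–Unger arXiv:2211.15742; settling: Dafermos–Luk arXiv:1710.01722 §1.2.1). WHY IT MIGHT FAIL: it
contains weak cosmic censorship for large data; and a cured member must ALSO avoid the bomb stratum
(codimension 1 for a real top mode), so along a single curve bomb parameters `c_n → 0` could accumulate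
— the repair is a 2-parameter family + general position (card escape-along-the-explosion, falsifier 3),
i.e. this stub with "curve" replaced by "curve inside a steerable 2-parameter family".
Sources: Christodoulou1999, arXiv:0805.3880, arXiv:1710.01722, arXiv:2211.15742, gr-qc/9402016. -/
def Sig.stub_nonSettlingCure : Prop :=
  ∀ (X : Type) [TopologicalSpace X] [ChartedSpace E3 X] [IsManifold (𝓡 3) ∞ X]
    [T2Space X] [SecondCountableTopology X] [ConnectedSpace X],
    ∀ D ∈ admissibleVacuumData X, ¬ SettlesWith (fun _ ↦ True) X D →
      ∃ (ε : ℝ) (F : EuclideanSpace ℝ (Fin 1) → InitialDataSet (𝓡 3) X), 0 < ε ∧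
        InitialDataSet.IsSmoothDataFamily 1 F ∧ F 0 = D ∧
        (∀ c c' : EuclideanSpace ℝ (Fin 1), |c 0| < ε → |c' 0| < ε → F c = F c' → c = c') ∧
        (∀ c : EuclideanSpace ℝ (Fin 1), |c 0| < ε → F c ∈ admissibleVacuumData X) ∧
        ∀ c : EuclideanSpace ℝ (Fin 1), c ≠ 0 → |c 0| < ε → SettlesWith ModeStable X (F c)

/-- **Stub 3 · `probeUniversality` — the Bridge: a scalar bomb is a gravitational bomb** (size XL,
conjectural; card stub ProbeUniversality = Disproof §6 note 1 option (b); shared with one-locked-explosion's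
`SpinRaisingBridge` and escape-along's `ScalarBombIsGravitationalBomb`; typed WITH horizon-regularity and
outgoing clauses as triage r1-1 (a)/(b) and r1-3 note 1 demand). A REGULAR stationary vacuum hole with
an adapted chart crossing `𝓗⁺` which is NOT Killing-mode-stable for `□_g` (a growing scalar Killing
mode, `ν > 0`, regular at `𝓗⁺`, outgoing) carries a growing GRAVITATIONAL Killing-mode pair
(`IsGravitationalModePair`: `DRic_g(hᵢ) = 0`, `𝓛_T`-eigenpair of rate `ν + iϖ`, `ν > 0`, regular at
`𝓗⁺`, chart-bounded on the far past part of the d.o.c., not pure gauge). WHY PLAUSIBLY TRUE: every known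
mechanism producing growing scalar modes on a stationary hole (superradiant amplification + confinement:
stable trapping of zero-energy null rays, Moschidis arXiv:1608.02041 Thms 2–3; ergoregions without
horizon, Friedman / arXiv:1608.02035) is spin-blind at the level of geometric optics and Gaussian beams /
quasimodes exist for linearised gravity as for scalars; in Kerr both sectors are mode-stable (Whiting 1989;
Andersson–Ma–Paganini–Whiting arXiv:1607.02759; Teixeira da Costa arXiv:1910.02854). WHY IT MIGHT FAIL: no
exact scalar→tensor dictionary exists on a general stationary vacuum background (Wald/Teukolsky
spin-raising needs type D; the Ehlers–Geroch linearisation gives only `T`-invariant perturbations), and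
Moschidis §1.3: trapping and fixed-frequency superradiant instabilities are logically unrelated — a
low-frequency scalar bomb need not have a tensor twin. Sources: arXiv:1608.02041, arXiv:1608.02035,
arXiv:1607.02759, arXiv:1910.02854, Whiting1989, arXiv:1501.02522. -/
def Sig.stub_probeUniversality : Prop :=
  ∀ (𝓑 : StationaryAFBlackHole.{0}) (A : 𝓑.AdaptedChart), RegularHole 𝓑 →
    𝓑.horizon ⊆ Set.range A.toFun → ¬ ModeStable 𝓑 →
      ∃ (ν ϖ : ℝ) (h₁ h₂ : HoleBilinField 𝓑), 0 < ν ∧ IsGravitationalModePair 𝓑 A ν ϖ h₁ h₂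

/-- **Stub 4 · `moncriefTransversality` — THE LEVER: compactly supported vacuum kicks realise every
finite set of non-gauge detectors** (size L; card A2 "Moncrief orthogonality" + A3, retyped as triage
r1-2 (a)/(b)/(c), r1-3 (a)/(b), r1-1 (a)/(d) demand: on the Cauchy slab of the DEVELOPMENT, Lorentzian,
detectors rough away from `x₀`, the KID caveat an explicit hypothesis). For an admissible `D`, any vacuum
Cauchy development `𝒟`, and `k` DETECTORS `(Aⱼ, Bⱼ)` at `x₀` (`AreDetectorsAt`: no local Killing initial
data at `x₀`; smooth near `x₀`; no non-trivial combination locally pure gauge = slice-tangent at `x₀`), and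
for every neighbourhood `V` of `x₀`: there is a jointly smooth `k`-parameter family `G` of ADMISSIBLE data,
`G 0 = D`, equal to `D` off a compact `K ⊆ V ∩ (chart source at x₀)`, whose tangents `∂_j G|₀` have
NON-DEGENERATE pairing matrix `det (ω((A_l, B_l), ∂_j G|₀))_{jl} ≠ 0` (slice pairing `chartPairing`).
WHY PLAUSIBLY TRUE: (i) linear Moncrief duality in `𝓓′(V)`: the `ω`-annihilator of
`ker DΦ ∩ C_c^∞(V)` is the range of `J∘DΦ*` on `𝓓′(V)` (Fredholm alternative for the underdetermined
elliptic linearised constraint map, whose adjoint — the Killing/Hessian operator `(N,Y) ↦ gauge(N,Y)` —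
has injective symbol), and where the combination is smooth the representing `(N, Y)` is smooth (elliptic
regularity), i.e. it IS a slice tangent — so independence mod local gauge gives `k` compactly supported
linearised solutions with invertible pairing matrix (linear algebra); (ii) no KIDs on `V` ⇒ the
constraint-solving data equal to `D` off `K` form a Banach manifold at `D` with tangent space the
`K`-supported linearised solutions (Corvino–Schoen, Chruściel–Delay Mém. SMF 94 (2003)), so the `k`
directions exponentiate to a smooth admissible family (admissibility, completeness and the AF end are
untouched off `K`; all `c` by the squash reparametrisation of `ConstraintFamilies.lean`). Junk check:
for `k = 0` it holds with `G = const D` (`det` of the empty matrix is `1`). WHY IT MIGHT FAIL: closedness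
of the range of `J∘DΦ*` on `𝓓′(V)` for a small ball `V` (boundary behaviour of the local splitting; the
printed splittings are global — compact `Σ`, Moncrief J. Math. Phys. 16 (1975) 493, Fischer–Marsden–Moncrief
Ann. IHP 33 (1980) — or weighted AF); if only a weaker local duality holds the stub must shrink `V`-freedom
to "some neighbourhood". Sources: doi:10.1063/1.522572 (Moncrief 1975), FischerMarsdenMoncrief1980,
Corvino–Schoen JDG 73 (2006) = gr-qc/0301071, Chruściel–Delay gr-qc/0301073, Beig–Chruściel–Schoen
gr-qc/0403042 (KIDs are non-generic), arXiv:1201.0463 (Hollands–Wald, gauge directions degenerate for ω). -/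
def Sig.stub_moncriefTransversality : Prop :=
  ∀ (X : Type) [TopologicalSpace X] [ChartedSpace E3 X] [IsManifold (𝓡 3) ∞ X]
    [T2Space X] [SecondCountableTopology X] [ConnectedSpace X],
    ∀ D ∈ admissibleVacuumData X, ∀ (𝒟 : VacuumCauchyDevelopment D) (x₀ : X) (k : ℕ)
      (A B : Fin k → BilinField X), AreDetectorsAt 𝒟 x₀ A B →
      ∀ V : Set X, IsOpen V → x₀ ∈ V →
        ∃ G : EuclideanSpace ℝ (Fin k) → InitialDataSet (𝓡 3) X,
          InitialDataSet.IsSmoothDataFamily k G ∧ G 0 = D ∧ (∀ c, G c ∈ admissibleVacuumData X) ∧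
          (∃ K : Set X, IsCompact K ∧ K ⊆ V ∧ K ⊆ (extChartAt (𝓡 3) x₀).source ∧
            IsSupportedIn D G K) ∧
          (pairingMatrix D x₀ A B G).det ≠ 0

/-- **Stub 5 · `dualModeEjection` — the symplectic dual of the bomb detects, and transversal steerable
families escape to mode-stable states** (size XL / open; = the card's construction (C): conservation of the
symplectic current A1 + the backward DUAL MODE normalised by `ω(H_T, h₊) = 1`, hence non-gauge, carried to
`Σ₀`; followed by the named residuals (S) SADDLE — strong-unstable shadowing near the hypothetical bomb,
Riesz projector of an isolated growing eigenvalue (TopModeGap) — and (F) FATE — the explosion settles and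
goodness is open along it, with steering in `k` directions past downstream bombs (escape-along-the-explosion's
residual directions / GeneralPosition)). For an admissible `D`, an MGHD `𝒟` with complete `𝓘⁺` and a
`C²` stationary decomposition (exterior `O`, exhaustive, collars, regular holes) whose hole `i` carries a
growing gravitational Killing-mode pair: there are a KID-free point `x₀ ∈ X` and finitely many DETECTORS
`(Aⱼ, Bⱼ)` at `x₀` (the Cauchy data on `Σ₀` of the dual modes of the bombs met along the escape, smooth near
`x₀`, independent mod local gauge) such that EVERY jointly smooth admissible `k`-parameter family `G`
through `D`, supported in a compact subset of the chart source at `x₀`, with non-degenerate pairing matrix,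
contains a jointly smooth curve `F` (`F 0 = D`, `F c = G(γ c)`, injective for `|c₀| < ε`) all of whose
members `0 < |c₀| < ε` settle to MODE-STABLE regular holes (`SettlesWith ModeStable`). Junk check: `k = 0`
is not a loophole (a curve inside a constant family cannot be injective). WHY PLAUSIBLY TRUE: first order —
`ω_{Σ₀}(H₀, ∂_jG|₀) = ω_{Σ_T}(H_T, ġ_j(T))` (conservation, no flux lost through Cauchy slices entering the
hole) is the growing-mode coefficient of the linearised development, so `det ≠ 0` means the family's tangent
plane maps ONTO the unstable plane(s); a one-ended complete admissible datum is not everywhere stationary, so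
KID-free points exist and (gauge potentials patching uniquely off KIDs) the globally non-gauge `H₀` is locally
non-gauge at one of them; nonlinear — DHRT-type finite-codimension stability/instability at the bomb
(arXiv:2104.08222 template at an unknown background), then capture of the explosion. WHY IT MIGHT FAIL: every
nonlinear input is conjectural at a hypothetical bomb (TopModeGap: isolated finite-multiplicity growing
eigenvalues are in print only for Warnick/Gajic–Warnick classes, arXiv:1306.5760, arXiv:1910.08479; shadowing
for the quasilinear flow with derivative loss; infinite bomb chains; capture of the explosion by Kerr far from
Kerr — `SlowlyRotatingKerrFrontier` applies); and the dual mode is only `C^{ν/κ}`-conormal where the backward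
light-sheet of the horizon meets `Σ₀` (triage r1-2 (b)), so `x₀` must avoid that 2-surface. Sources:
doi:10.1098/rspa.1990.0080 (Burnett–Wald), arXiv:1201.0463, arXiv:1501.02522 (Prabhu–Wald), arXiv:2104.08222,
arXiv:1306.5760, arXiv:1910.08479, NakanishiSchlag2011 (invariant manifolds for dispersive saddles). -/
def Sig.stub_dualModeEjection : Prop :=
  ∀ (X : Type) [TopologicalSpace X] [ChartedSpace E3 X] [IsManifold (𝓡 3) ∞ X]
    [T2Space X] [SecondCountableTopology X] [ConnectedSpace X],
    ∀ D ∈ admissibleVacuumData X, ∀ (𝒟 : VacuumCauchyDevelopment D), 𝒟.IsMaximal →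
      Summit.FinalStateConjecture.HasCompleteNullInfinity 𝒟.toCauchyDevelopment →
      ∀ (O : Set 𝒟.carrier) (d : StationaryFinalStateDecomposition 𝒟.toSpacetime O 2),
        O = Summit.FinalStateConjecture.exteriorOf 𝒟.toCauchyDevelopment d.charted →
        d.HasExhaustiveCharts →
        (∀ i, (d.hole i).horizon ⊆ Set.range (d.adapted i).toFun ∧ RegularHole (d.hole i)) →
        ∀ (i : Fin d.N) (ν ϖ : ℝ) (h₁ h₂ : HoleBilinField (d.hole i)), 0 < ν →
          IsGravitationalModePair (d.hole i) (d.adapted i) ν ϖ h₁ h₂ →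
          ∃ (x₀ : X) (k : ℕ) (A B : Fin k → BilinField X), AreDetectorsAt 𝒟 x₀ A B ∧
            ∀ G : EuclideanSpace ℝ (Fin k) → InitialDataSet (𝓡 3) X,
              InitialDataSet.IsSmoothDataFamily k G → G 0 = D → (∀ c, G c ∈ admissibleVacuumData X) →
              (∃ K : Set X, IsCompact K ∧ K ⊆ (extChartAt (𝓡 3) x₀).source ∧ IsSupportedIn D G K) →
              (pairingMatrix D x₀ A B G).det ≠ 0 →
              ∃ (ε : ℝ) (F : EuclideanSpace ℝ (Fin 1) → InitialDataSet (𝓡 3) X), 0 < ε ∧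
                InitialDataSet.IsSmoothDataFamily 1 F ∧ F 0 = D ∧
                (∀ c, ∃ c', F c = G c') ∧
                (∀ c c' : EuclideanSpace ℝ (Fin 1), |c 0| < ε → |c' 0| < ε → F c = F c' → c = c') ∧
                ∀ c : EuclideanSpace ℝ (Fin 1), c ≠ 0 → |c 0| < ε → SettlesWith ModeStable X (F c)

/-! ## §2 Registered stubs (`sorry` lives ONLY here) -/

/-- Stub 1 (L): Kerr-isometric stationary limits give the summit's Kerr–Schild decomposition. -/
theorem stub_kerrChartTransfer : Sig.stub_kerrChartTransfer := by
  sorry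

/-- Stub 2 (open problem): the global half — non-settling data are curable into mode-stably settling data. -/
theorem stub_nonSettlingCure : Sig.stub_nonSettlingCure := by
  sorry

/-- Stub 3 (XL, conjectural): the Bridge — a scalar bomb is a gravitational bomb. -/
theorem stub_probeUniversality : Sig.stub_probeUniversality := by
  sorry

/-- Stub 4 (L, THE LEVER): Moncrief transversality — compactly supported admissible kicks realise detectors. -/
theorem stub_moncriefTransversality : Sig.stub_moncriefTransversality := by
  sorry

/-- Stub 5 (XL/open): the dual modes detect; transversal steerable families escape to mode-stable states. -/
theorem stub_dualModeEjection : Sig.stub_dualModeEjection := by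
  sorry

/-! ## §3 Glue lemmas (sorry-free) -/

section Glue

variable {X : Type} [TopologicalSpace X] [ChartedSpace E3 X] [IsManifold (𝓡 3) ∞ X]
  [T2Space X] [SecondCountableTopology X] [ConnectedSpace X]

/-- `KerrOrBomb` applied to a regular, Killing-mode-stable hole (instances discharged by the tree's
`hasLeviCivita` and `kerrFacts`). -/
theorem isKerrIsometric_of_kerrOrBomb [Kerr.Facts] (hK : KerrOrBomb) (𝓑 : StationaryAFBlackHole.{0})
    (hreg : RegularHole 𝓑) (hms : ModeStable 𝓑) : IsKerrIsometric 𝓑 := by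
  haveI : 𝓑.metric.HasLeviCivita := 𝓑.metric.hasLeviCivita
  unfold RegularHole at hreg
  unfold ModeStable at hms
  obtain ⟨h1, h2, h3, h4, h5⟩ := hreg
  exact hK 𝓑 h1 h2 h3 h4 h5 hms

/-- **Settling to mode-stable regular holes ⇒ the summit property**, given `KerrOrBomb` (each limit hole
is a sub-extremal Kerr exterior), the chart transfer (Stub 1) and MGHD existence (the `∃`-conjunct). -/
theorem summitProperty_of_settlesWith [Kerr.Facts] (hK : KerrOrBomb) (hT : Sig.stub_kerrChartTransfer)
    (hMGHD : Summit.FinalStateConjecture.FinalStateConjecture.Theses.SwallowTheDatum.MGHDExists)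
    {D : InitialDataSet (𝓡 3) X} (hD : D ∈ admissibleVacuumData X) (h : SettlesWith ModeStable X D) :
    SummitProperty X D := by
  refine ⟨hMGHD X D hD, fun 𝒟 h𝒟 ↦ ?_⟩
  obtain ⟨hcni, O, d, hO, hex, hholes⟩ := h 𝒟 h𝒟
  refine ⟨hcni, ?_⟩
  have hKerr : ∀ i, IsKerrIsometric (d.hole i) := fun i ↦
    isKerrIsometric_of_kerrOrBomb hK (d.hole i) (hholes i).2.1 (hholes i).2.2
  obtain ⟨O', d', hsub, hO', hex'⟩ :=
    hT X D 𝒟 O d hO hex (fun i ↦ ⟨(hholes i).1, (hholes i).2.1⟩) hKerr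
  exact ⟨O', d', hsub, hO', hex'⟩

/-- **A regularly settling datum that does not settle to mode-stable holes carries a BOMB**: some MGHD,
some exhaustive regular decomposition of its exterior, some hole which is not Killing-mode-stable
(classical logic). -/
theorem exists_bomb {D : InitialDataSet (𝓡 3) X} (hS : SettlesWith (fun _ ↦ True) X D)
    (hnot : ¬ SettlesWith ModeStable X D) :
    ∃ (𝒟 : VacuumCauchyDevelopment D), 𝒟.IsMaximal ∧
      Summit.FinalStateConjecture.HasCompleteNullInfinity 𝒟.toCauchyDevelopment ∧
      ∃ (O : Set 𝒟.carrier) (d : StationaryFinalStateDecomposition 𝒟.toSpacetime O 2),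
        O = Summit.FinalStateConjecture.exteriorOf 𝒟.toCauchyDevelopment d.charted ∧
        d.HasExhaustiveCharts ∧
        (∀ i, (d.hole i).horizon ⊆ Set.range (d.adapted i).toFun ∧ RegularHole (d.hole i)) ∧
        ∃ i, ¬ ModeStable (d.hole i) := by
  by_contra hcon
  apply hnot
  intro 𝒟 h𝒟
  obtain ⟨hcni, O, d, hO, hex, hholes⟩ := hS 𝒟 h𝒟
  refine ⟨hcni, O, d, hO, hex, fun i ↦ ⟨(hholes i).1, (hholes i).2.1, ?_⟩⟩
  by_contra hi
  exact hcon ⟨𝒟, h𝒟, hcni, O, d, hO, hex, fun j ↦ ⟨(hholes j).1, (hholes j).2.1⟩, i, hi⟩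

end Glue

/-! ## §4 The composition (kernel-checked; concludes the crux BY NAME)

Hypotheses: the five stub signatures and the shared obligation `MGHDExists` (stmt-9937, route item of
SwallowTheDatum, staffed once for the summit; Disproof §3 of the sibling TameCensorship crux shows it is
load-bearing for any genericity proof). `KerrOrBomb`, the crux's own hypothesis, is introduced by `intro`
and used three times. -/

/-- **`StationaryLimitReduction_of`** — the symplectic dual of the bomb: the crux
`KerrOrBomb → FinalStateConjecture` from the five stubs and `MGHDExists`, datum by datum. -/
theorem StationaryLimitReduction_of
    (hMGHD : Summit.FinalStateConjecture.FinalStateConjecture.Theses.SwallowTheDatum.MGHDExists)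
    (hT : Sig.stub_kerrChartTransfer) (hN : Sig.stub_nonSettlingCure)
    (hP : Sig.stub_probeUniversality) (hM : Sig.stub_moncriefTransversality)
    (hE : Sig.stub_dualModeEjection) :
    Summit.FinalStateConjecture.FinalStateConjecture.Theses.ZeroEnergyKerrOrBomb.StationaryLimitReduction := by
  intro hK X _ _ _ _ _ _
  haveI : Kerr.Facts := kerrFacts
  refine Summit.FinalStateConjecture.FinalStateConjecture.Theorems.PhotonSphereChannels.isChristodoulouGeneric_one_of_local ?_
  intro D hD hnotP
  by_cases hS : SettlesWith (fun _ ↦ True) X D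
  · -- Case A: every MGHD of `D` settles to regular holes; `D` being exceptional, one of them is a bomb
    have key : ¬ SettlesWith ModeStable X D :=
      fun h ↦ hnotP (summitProperty_of_settlesWith hK hT hMGHD hD h)
    obtain ⟨𝒟, h𝒟, hcni, O, d, hO, hex, hreg, i, hbomb⟩ := exists_bomb hS key
    -- the Bridge: the scalar bomb is a gravitational bomb
    obtain ⟨ν, ϖ, h₁, h₂, hν, hmode⟩ := hP (d.hole i) (d.adapted i) (hreg i).2 (hreg i).1 hbomb
    -- the symplectic dual of the bomb: detectors on `Σ₀` + ejection/fate along steerable families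
    obtain ⟨x₀, k, A, B, hdet, hsteer⟩ :=
      hE X D hD 𝒟 h𝒟 hcni O d hO hex hreg i ν ϖ h₁ h₂ hν hmode
    -- Moncrief transversality: a steerable compactly supported admissible family in the chart at `x₀`
    obtain ⟨G, hG, hG0, hGadm, ⟨K, hKc, -, hKsrc, hsupp⟩, hdetG⟩ :=
      hM X D hD 𝒟 x₀ k A B hdet (extChartAt (𝓡 3) x₀).source (isOpen_extChartAt_source x₀)
        (mem_extChartAt_source x₀)
    obtain ⟨ε, F, hε, hF, hF0, hFG, hinj, hgood⟩ := hsteer G hG hG0 hGadm ⟨K, hKc, hKsrc, hsupp⟩ hdetG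
    have hFadm : ∀ c, F c ∈ admissibleVacuumData X := fun c ↦ by
      obtain ⟨c', hc'⟩ := hFG c
      rw [hc']
      exact hGadm c'
    exact ⟨ε, F, hε, hF, hF0, hinj, fun c _ ↦ hFadm c, fun c hc hcε ↦
      summitProperty_of_settlesWith hK hT hMGHD (hFadm c) (hgood c hc hcε)⟩
  · -- Case B: `D` does not settle regularly: the global half cures it
    obtain ⟨ε, F, hε, hF, hF0, hinj, hadm, hgood⟩ := hN X D hD hS
    exact ⟨ε, F, hε, hF, hF0, hinj, hadm, fun c hc hcε ↦
      summitProperty_of_settlesWith hK hT hMGHD (hadm c hcε) (hgood c hc hcε)⟩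

/-! ## §5 Negative checks (landed `Negative/` lemmas this skeleton is read against)

* `Theorems.StationaryLimitReduction.Negative.not_stationaryLimitReduction_iff` (KillShape, p72863): a kill is
  `KerrOrBomb ∧ ¬FSC`; nothing here is of that shape, and the composition USES `KerrOrBomb`.
* `Theorems.TameCensorship.Negative.not_isChristodoulouGeneric_and_closed`: `∧`-closure of curve-genericity is
  false; no stub is an `∧`-closure schema (each existential curve carries the single conjunctive property
  `SettlesWith ModeStable`). -/

example : ¬ StationaryLimitReduction ↔ (KerrOrBomb ∧ ¬ _root_.FinalStateConjecture) :=
  Summit.FinalStateConjecture.FinalStateConjecture.Theorems.StationaryLimitReduction.Negative.not_stationaryLimitReduction_iff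

example : True := by
  have _neg :=
    @Summit.FinalStateConjecture.FinalStateConjecture.Theorems.TameCensorship.Negative.not_isChristodoulouGeneric_and_closed
  trivial

end Summit.FinalStateConjecture.FinalStateConjecture.Cruxes.StationaryLimitReduction.SymplecticDualOfTheBomb

end
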